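import Mathlib
import HarnessLib.Audit
import Summits.PneNP.PneNP.Theorems.PstarCrossRegime
import Summits.PneNP.PneNP.Theorems.PstarChordBridgeBasis

/-!
# The blind free CROSS gate, regime P: the single-read facts of the virtual system (nodes N1/N2; O2 / E1; prover-1 g22)

FRONTIER range-avoidance ladder, rung F-N3 (`stmt-PneNP-19007`), cell `pnp-ideate`; restricted-model proof complexity — nothing here bears on `P` versus `NP`.

Cross data `B` (`PstarCrossData.CrossData I r B e_p e_q g₀`), virtual system `V = (sys I B).vsys e_p e_q` on `N₁ = N.erase e_q`, in REGIME P
(`V.SingleRead`: every read vector lies on the line of `(1,0)`, nodes `PstarCrossNodes.CrossCasePEmpty` / `CrossCasePChords`).  Then the second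
constraint is state-free, `q := q_{(1,0)} = F₂ + t₂` (`PstarChordBridgeBasis.qDir I B (1,0)`), `Z := Z(q)`, and:

* `qDir10_eq` — `q_{(1,0)} a = (V.F a).2 + V.t.2`;
* `forced_of_q` — (★★) every chord of `N₁` is ON on `Z` (`PstarChordSystem.star_star`); in particular
  `orU_of_q` — **`Z ⊆ {u_p ∨ u_q = 1}`** (the CORNER `{u_p = u_q = 0}` misses `Z`) and `u_of_q` — every real chord `e ∈ N₁ ∖ e_p` has `u_e ≡ 1` on `Z`;
* `qDir01_of_q` — **`q_{(0,1)} ≡ 1 + σ₁` on `Z`**, `σ₁ = Σ_{e ∈ N₁} ((ρ_e)₁ + (ρ'_e)₁)` (the all-ON state would otherwise hit the target): the quadratic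
  `F₁ + t₁ + 1 + σ₁` VANISHES on `Z(q)` — rank rigidity (`PstarRankRigidity*`) applies;
* `exists_q_p`, `exists_q_q` — `Z` meets `{u_p = 1, u_q = 0}` and `{u_p = 0, u_q = 1}` (the (M0) witnesses of `e_p`, `e_q`);
* `forced_cases_real` — for a REAL chord `e ∈ N₁ ∖ e_p`: (EQ) `Q_{D e} = q + κ`, (EXC) `Q_{D e} = q + ν₁ν₂ + κ`, or (NOR) w.r.t. `q`
  (`PstarChordForcing.forced_chord_cases` on the virtual system — its hypotheses are about `F`, which the virtual system shares with `sys I B`,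
  and about `u_e = γ_e + Q_{D e}` of rank `≥ 4`, `PstarChordBridgeForcing.sys_u_eq` / `rank_four_of_wf`).
-/

set_option linter.dupNamespace false -- `Summit.PneNP.PneNP.…`: summit = sub-problem name (D-0017 single-conjunct layout)

open Finset Module Literature.Computability.Complexity
open Summit.PneNP.PneNP.Theorems.PstarFibrePolys (bit)
open Summit.PneNP.PneNP.Theorems.PstarTyped (Typed)
open Summit.PneNP.PneNP.Theorems.PstarSALevel (varSet bdry BoundaryExpanding SimpleOverlap)
open Summit.PneNP.PneNP.Theorems.PstarCubeIdeals (IsAffineFn)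
open Summit.PneNP.PneNP.Theorems.PstarQuadRank (rad)
open Summit.PneNP.PneNP.Theorems.PstarProductRank (qform polar)
open Summit.PneNP.PneNP.Theorems.PstarReadSumset (V2)
open Summit.PneNP.PneNP.Theorems.PstarChordSystem (ChordSystem)
open Summit.PneNP.PneNP.Theorems.PstarChordBridgeTools
open Summit.PneNP.PneNP.Theorems.PstarChordBridge
open Summit.PneNP.PneNP.Theorems.PstarChordBridgeForcing (freePolar gam sys_q_add sys_u_eq qform_add' rank_four_of_wf)
open Summit.PneNP.PneNP.Theorems.PstarChordBridgeBasis (qDir polarDir)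
open Summit.PneNP.PneNP.Theorems.PstarChordForcing (forced_chord_cases)
open Summit.PneNP.PneNP.Theorems.PstarCrossData (CrossData)
open Summit.PneNP.PneNP.Theorems.PstarCrossSystem
open Summit.PneNP.PneNP.Theorems.PstarCrossRegime (exists_witness_p exists_witness_q)

namespace Summit.PneNP.PneNP.Theorems.PstarCrossCaseP

variable {n m : ℕ}

section

variable (I : LocalMap 4 n m) {r : ℕ} {B : BridgeData n m} {e_p e_q g₀ : Fin m}

/-- `q_{(1,0)}` is the second constraint's state-free part plus its target (virtual or not). -/
theorem qDir10_eq (B : BridgeData n m) (e_p e_q : Fin m) (a : Fin n → ZMod 2) :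
    qDir I B (1, 0) a = (((sys I B).vsys e_p e_q).F a).2 + ((sys I B).vsys e_p e_q).t.2 := by
  unfold PstarChordBridgeBasis.qDir
  simp only [ChordSystem.vsys_F, ChordSystem.vsys_t, sys_F, sys_t, zero_mul, one_mul, zero_add]

/-- `q_{(0,1)}` is the first constraint's state-free part plus its target. -/
theorem qDir01_eq (B : BridgeData n m) (e_p e_q : Fin m) (a : Fin n → ZMod 2) :
    qDir I B (0, 1) a = (((sys I B).vsys e_p e_q).F a).1 + ((sys I B).vsys e_p e_q).t.1 := by
  unfold PstarChordBridgeBasis.qDir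
  simp only [ChordSystem.vsys_F, ChordSystem.vsys_t, sys_F, sys_t, zero_mul, one_mul, add_zero]

/-- **(★★) in regime P**: every chord of `N.erase e_q` is ON on `Z(q_{(1,0)})`. -/
theorem forced_of_q (hI : I.IsPure xorAndPred) (hT : Typed I) (hD : CrossData I r B e_p e_q g₀) (hSR : ((sys I B).vsys e_p e_q).SingleRead)
    {e : Fin m} (he : e ∈ B.N.erase e_q) {a : Fin n → ZMod 2} (ha : qDir I B (1, 0) a = 0) : ((sys I B).vsys e_p e_q).u e a = 1 := by
  refine ((sys I B).vsys e_p e_q).star_star hSR (vsys_const I hD) (vsys_infeasible I hI hT hD) he (vsys_chordMinimal I hI hT hD he) a ?_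
  rw [qDir10_eq] at ha
  have e0 : ∀ s g : ZMod 2, s + g = 0 → s = g := by decide
  exact e0 _ _ ha

/-- **`Z(q) ⊆ {u_p ∨ u_q = 1}`**: the corner misses `Z`. -/
theorem orU_of_q (hI : I.IsPure xorAndPred) (hT : Typed I) (hD : CrossData I r B e_p e_q g₀) (hSR : ((sys I B).vsys e_p e_q).SingleRead)
    {a : Fin n → ZMod 2} (ha : qDir I B (1, 0) a = 0) : (sys I B).orU e_p e_q a = 1 := by
  have h := forced_of_q I hI hT hD hSR (mem_erase.2 ⟨hD.ne, hD.mem_p⟩) ha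
  rwa [ChordSystem.vsys_u_self] at h

/-- **Every real chord of `N.erase e_q` other than `e_p` is ON on `Z(q)`.** -/
theorem u_of_q (hI : I.IsPure xorAndPred) (hT : Typed I) (hD : CrossData I r B e_p e_q g₀) (hSR : ((sys I B).vsys e_p e_q).SingleRead)
    {e : Fin m} (he : e ∈ B.N.erase e_q) (hne : e ≠ e_p) {a : Fin n → ZMod 2} (ha : qDir I B (1, 0) a = 0) : (sys I B).u e a = 1 := by
  have h := forced_of_q I hI hT hD hSR he ha
  rwa [ChordSystem.vsys_u_of_ne _ _ _ hne] at h

/-- **`q_{(0,1)} ≡ 1 + σ₁` on `Z(q_{(1,0)})`**: the all-ON state would otherwise hit the target. -/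
theorem qDir01_of_q (hI : I.IsPure xorAndPred) (hT : Typed I) (hD : CrossData I r B e_p e_q g₀) (hSR : ((sys I B).vsys e_p e_q).SingleRead)
    {a : Fin n → ZMod 2} (ha : qDir I B (1, 0) a = 0) :
    qDir I B (0, 1) a = 1 + ∑ e ∈ B.N.erase e_q, ((((sys I B).vsys e_p e_q).ρ e a).1 + (((sys I B).vsys e_p e_q).ρ' e a).1) := by
  classical
  set V := (sys I B).vsys e_p e_q with hV
  -- the all-ON state is admissible at `a`
  let s : Fin m → ZMod 2 × ZMod 2 := fun _ => (1, 1)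
  have hadm : V.Adm (B.N.erase e_q) a s := fun e he => by
    show (1 : ZMod 2) * 1 = V.u e a
    rw [one_mul]; exact (forced_of_q I hI hT hD hSR he ha).symm
  have hne := vsys_infeasible I hI hT hD a s hadm
  -- its value: second coordinate on target, so the first is off target
  have hval : V.val (B.N.erase e_q) a s = V.F a + ∑ e ∈ B.N.erase e_q, (V.ρ e a + V.ρ' e a) := by
    unfold ChordSystem.val ChordSystem.contrib
    simp only [s, one_smul]
  have h2 : (V.val (B.N.erase e_q) a s).2 = V.t.2 := by
    rw [V.val_snd_of_singleRead hSR]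
    rw [qDir10_eq] at ha
    have e0 : ∀ x y : ZMod 2, x + y = 0 → x = y := by decide
    exact e0 _ _ ha
  have h1 : (V.val (B.N.erase e_q) a s).1 ≠ V.t.1 := fun h => hne (Prod.ext h h2)
  rw [hval, Prod.fst_add, Prod.fst_sum] at h1
  rw [qDir01_eq]
  simp only [Prod.fst_add] at h1 ⊢
  have e1 : ∀ f σ t : ZMod 2, f + σ ≠ t → f + t = 1 + σ := by decide
  exact e1 _ _ _ h1

/-- **`Z(q)` meets `{u_p = 1, u_q = 0}`** (the (M0) witness of `e_p`). -/
theorem exists_q_p (hI : I.IsPure xorAndPred) (hT : Typed I) (hD : CrossData I r B e_p e_q g₀) (hSR : ((sys I B).vsys e_p e_q).SingleRead) :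
    ∃ a : Fin n → ZMod 2, qDir I B (1, 0) a = 0 ∧ (sys I B).u e_p a = 1 ∧ (sys I B).u e_q a = 0 := by
  obtain ⟨a, s, -, hval, -, hp, hq⟩ := exists_witness_p I hI hT hD
  refine ⟨a, ?_, hp, hq⟩
  rw [qDir10_eq, ← ((sys I B).vsys e_p e_q).val_snd_of_singleRead hSR (B.N.erase e_q) a s, hval]
  exact CharTwo.add_self_eq_zero _

/-- **`Z(q)` meets `{u_p = 0, u_q = 1}`** (the (M0) witness of `e_q`). -/
theorem exists_q_q (hI : I.IsPure xorAndPred) (hT : Typed I) (hD : CrossData I r B e_p e_q g₀) (hSR : ((sys I B).vsys e_p e_q).SingleRead) :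
    ∃ a : Fin n → ZMod 2, qDir I B (1, 0) a = 0 ∧ (sys I B).u e_p a = 0 ∧ (sys I B).u e_q a = 1 := by
  obtain ⟨a, s, -, hval, -, hp, hq⟩ := exists_witness_q I hI hT hD
  refine ⟨a, ?_, hp, hq⟩
  rw [qDir10_eq, ← ((sys I B).vsys e_p e_q).val_snd_of_singleRead hSR (B.N.erase e_q) a s, hval]
  exact CharTwo.add_self_eq_zero _

/-- **The forcing trichotomy for a REAL chord in regime P** (`PstarChordForcing.forced_chord_cases` on the virtual system): (EQ), (EXC) or (NOR)
w.r.t. `q = F₂ + t₂`. -/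
theorem forced_cases_real (hI : I.IsPure xorAndPred) (hT : Typed I) (hS : SimpleOverlap I) (hB : BoundaryExpanding r I)
    (hD : CrossData I r B e_p e_q g₀) (hSR : ((sys I B).vsys e_p e_q).SingleRead) {e : Fin m} (he : e ∈ B.N.erase e_q) (hne : e ≠ e_p) :
    (∃ κ : ZMod 2, ∀ x, qform (B.D e) (fun j => I.vars j 2) (fun j => I.vars j 3) x = (((sys I B).F x).2 + (sys I B).t.2) + κ) ∨
    (∃ ν₁ ν₂ : (Fin n → ZMod 2) → ZMod 2, IsAffineFn ν₁ ∧ IsAffineFn ν₂ ∧ ∃ κ : ZMod 2, ∀ x,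
      qform (B.D e) (fun j => I.vars j 2) (fun j => I.vars j 3) x = (((sys I B).F x).2 + (sys I B).t.2) + ν₁ x * ν₂ x + κ) ∨
    (∃ a b : Fin n → ZMod 2, freePolar I B.N B.T₂ B.G₂ a b = 1 ∧
      (∀ x, ((sys I B).F x).2 + (sys I B).t.2 =
        (freePolar I B.N B.T₂ B.G₂ x b + ((((sys I B).F b).2 + (sys I B).t.2) + (((sys I B).F 0).2 + (sys I B).t.2))) *
          (freePolar I B.N B.T₂ B.G₂ x a + ((((sys I B).F a).2 + (sys I B).t.2) + (((sys I B).F 0).2 + (sys I B).t.2))) + 1) ∧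
      ∃ m₁ m₂ : (Fin n → ZMod 2) → ZMod 2, IsAffineFn m₁ ∧ IsAffineFn m₂ ∧
        ∀ x, qform (B.D e) (fun j => I.vars j 2) (fun j => I.vars j 3) x + (gam B e + 1) =
          (freePolar I B.N B.T₂ B.G₂ x b + ((((sys I B).F b).2 + (sys I B).t.2) + (((sys I B).F 0).2 + (sys I B).t.2)) + 1) * m₁ x +
          (freePolar I B.N B.T₂ B.G₂ x a + ((((sys I B).F a).2 + (sys I B).t.2) + (((sys I B).F 0).2 + (sys I B).t.2)) + 1) * m₂ x) := by
  have hJr : B.J₀.card ≤ r := le_trans (card_le_card (subset_union_left.trans subset_union_left)) hD.rad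
  have heN : e ∈ B.N := mem_of_mem_erase he
  exact forced_chord_cases ((sys I B).vsys e_p e_q) hSR (vsys_const I hD) (vsys_infeasible I hI hT hD) he (vsys_chordMinimal I hI hT hD he)
    (sys_q_add I B) (fun a => by rw [ChordSystem.vsys_u_of_ne _ _ _ hne]; exact sys_u_eq I B e a) (qform_add' I (B.D e))
    (rank_four_of_wf I hI hS hB hD.wf hJr heN)

end

end Summit.PneNP.PneNP.Theorems.PstarCrossCaseP
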